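import Summits.CriticalPhenomena.SAWScalingLimit.Theorems.SAWLoopFugacityFlowIsingBoundaryRatioWindowRectPolygonAvoid
import Literature.Topology.PlaneTopology.WindingNumberCrossing
import HarnessLib

/-!
# The offset boundary polygon: the winding number jumps by one across each of its buds
(line `fk-anchor-transfer`, crux `IsingBoundaryRatio`, stmt-CriticalPhenomena-10650; helper file of the stub
`windowRectPresentation_holds`)

Let `d₀` be an external dart of `E` with `succ^[N] d₀ = d₀` and the darts `succ^[i] d₀`, `i < N`, pairwise
distinct, and let `Γ = arcPath E δ η d₀ N` be the closed offset boundary polygon (`0 < η`, `4η ≤ δ`). For an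
arrow `d = (x, k)` put, in its frame, the two TEST POINTS `ℓ_d = (η - η/4, η/2)` (just inside the square about
`δx`) and `r_d = (η + η/4, η/2)` (just outside, beyond the side of `d`). We prove
(`wind_test_eq_add_one`, `wind_test_eq`):

* if `d = succ^[j] d₀` is a dart of the cycle, `wind (Γ - ℓ_d) = wind (Γ - r_d) + 1`;
* if `d` is an external dart NOT on the cycle, `wind (Γ - ℓ_d) = wind (Γ - r_d)`.

Proof: the crossing defect `crossInc` of `ArgumentIncrement.lean` is additive along the pieces of `Γ`
(`crossInc_trans`); every piece avoids the test segment `[ℓ_d, r_d]` (`PolygonAvoid`) except the half-side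
`[bud d, end d]` of the dart `d` itself, which crosses it once from the positive to the negative side
(`crossInc_segment_of_cross`, the side functional being computed in the frame of `d`), and
`crossInc = 2πi (wind (Γ - ℓ) - wind (Γ - r))` for loops (`crossInc_loop`). [folklore]
-/

noncomputable section

open scoped Classical Real
open Set Complex Literature.Probability.LatticeModels Literature.Probability.LatticeModels.DiscreteRect
open Literature.Topology.PlaneTopology

namespace Summit.CriticalPhenomena.SAWScalingLimit.Theorems.IsingBoundaryRatio

namespace WindowRect

variable {δ η : ℝ} {E : Finset (Sym2 (Site 2))}

/-! ### The side functional in a frame -/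

/-- **The side functional in frame coordinates**: for three points of one frame it is the cross product of
the coordinate differences (the frame is a direct orthonormal frame). [folklore] -/
theorem segSide_framePt (x : Site 2) (k : Fin 4) (a₁ b₁ a₂ b₂ a b : ℝ) :
    segSide (framePt δ (x, k) a₁ b₁) (framePt δ (x, k) a₂ b₂) (framePt δ (x, k) a b) =
      (b - b₁) * (a - a₂) - (a - a₁) * (b - b₂) := by
  rw [segSide_eq]
  simp only [sub_re, sub_im, framePt_re, framePt_im, dir_succ_apply_zero, dir_succ_apply_one, Int.cast_neg]
  rcases dir_apply_cases k with ⟨h0, h1⟩ | ⟨h0, h1⟩ | ⟨h0, h1⟩ | ⟨h0, h1⟩ <;>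
    simp only [h0, h1, Int.cast_one, Int.cast_zero, Int.cast_neg] <;> ring

/-! ### The test segment of an arrow and the pieces of the polygon -/

/-- A point of the test segment `[ℓ_d, r_d]` is a frame point `(η + u, η/2)` with `|u| ≤ η/4`. [folklore] -/
theorem exists_of_mem_testSegment (hη : 0 < η) (x : Site 2) (k : Fin 4) {z : ℂ}
    (hz : z ∈ segment ℝ (framePt δ (x, k) (η - η / 4) (η / 2)) (framePt δ (x, k) (η + η / 4) (η / 2))) :
    ∃ u : ℝ, |u| < η ∧ z = framePt δ (x, k) (η + u) (η / 2) := by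
  obtain ⟨t, ⟨ht0, ht1⟩, rfl⟩ := exists_of_mem_segment_fst (by linarith) hz
  exact ⟨t - η, by rw [abs_lt]; constructor <;> linarith, by rw [add_sub_cancel]⟩

/-- `|η/2| < η`. [folklore] -/
theorem abs_half_lt (hη : 0 < η) : |η / 2| < η := by rw [abs_of_pos (by positivity)]; linarith

/-- **A side piece meets the test segment of `d` only if it is the side of `d`**, and then only at the
frame point `(η, η/2)`. [folklore] -/
theorem eq_of_side_mem_testSegment (hδ : 0 < δ) (hη : 0 < η) (h4 : 4 * η ≤ δ) {x : Site 2} {k : Fin 4}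
    {d' : Site 2 × Fin 4} {z : ℂ} (hz : z ∈ segment ℝ (framePt δ d' η (-η)) (framePt δ d' η η))
    (hz' : z ∈ segment ℝ (framePt δ (x, k) (η - η / 4) (η / 2)) (framePt δ (x, k) (η + η / 4) (η / 2))) :
    d' = (x, k) ∧ z = framePt δ (x, k) η (η / 2) := by
  obtain ⟨v, K⟩ := d'
  obtain ⟨u, hu, rfl⟩ := exists_of_mem_testSegment hη x k hz'
  obtain ⟨h1, h2⟩ := test_side hδ hη h4 hu (abs_half_lt hη) hz
  exact ⟨h1, by rw [h2, add_zero]⟩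

/-- **Connector points miss the test segment.** [folklore] -/
theorem not_conn_mem_testSegment (hδ : 0 < δ) (hη : 0 < η) (h4 : 4 * η ≤ δ) {x : Site 2} {k : Fin 4}
    {e : Site 2 × Fin 4} (he : aedge e ∈ E) {t₀ : ℝ} (ht₀ : t₀ ∈ Icc η (δ - η)) {z : ℂ}
    (hz : z = framePt δ e t₀ η ∨ z = framePt δ e t₀ (-η))
    (hz' : z ∈ segment ℝ (framePt δ (x, k) (η - η / 4) (η / 2)) (framePt δ (x, k) (η + η / 4) (η / 2))) :
    False := by
  obtain ⟨u, hu, rfl⟩ := exists_of_mem_testSegment hη x k hz'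
  exact test_not_conn hδ hη h4 hu (abs_half_lt hη) he ht₀ hz

/-- The test points are not on the polygon from any dart. [folklore] -/
theorem testPt_not_mem_range_arcPath (hδ : 0 < δ) (hη : 0 < η) (h4 : 4 * η ≤ δ) (x : Site 2) (k : Fin 4)
    {u : ℝ} (hu : |u| < η) (hu0 : u ≠ 0) (d : Site 2 × Fin 4) (m : ℕ) :
    framePt δ (x, k) (η + u) (η / 2) ∉ range (arcPath E δ η d m) := by
  intro h
  rcases range_arcPath_subset hη (by linarith) d m h with ⟨i, -, hi⟩ | ⟨e, he, t, ht, hz⟩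
  · exact hu0 (test_side hδ hη h4 hu (abs_half_lt hη) hi).2
  · exact test_not_conn hδ hη h4 hu (abs_half_lt hη) he ht hz

/-- The test points are not on one step of the polygon. [folklore] -/
theorem testPt_not_mem_range_stepPath (hδ : 0 < δ) (hη : 0 < η) (h4 : 4 * η ≤ δ) (x : Site 2) (k : Fin 4)
    {u : ℝ} (hu : |u| < η) (hu0 : u ≠ 0) (d : Site 2 × Fin 4) :
    framePt δ (x, k) (η + u) (η / 2) ∉ range (stepPath E δ η d) := by
  have h := testPt_not_mem_range_arcPath (E := E) hδ hη h4 x k hu hu0 d 1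
  rw [range_arcPath_succ] at h
  exact fun h' => h (Or.inl h')

/-- `|-(η/4)| < η`, `|η/4| < η` and `∓η/4 ≠ 0`: the test offsets. [folklore] -/
theorem test_offsets (hη : 0 < η) : |(-(η / 4))| < η ∧ |η / 4| < η ∧ -(η / 4) ≠ 0 ∧ η / 4 ≠ 0 := by
  refine ⟨?_, ?_, by linarith, by linarith⟩
  · rw [abs_neg, abs_of_pos (by positivity)]; linarith
  · rw [abs_of_pos (by positivity)]; linarith

/-! ### Crossing defects of the pieces -/

/-- A segment contained in a side or a connector, other than the second half-side of `d`, misses the test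
segment: zero crossing defect. Form used: a segment all of whose common points with the test segment would
be `framePt δ (x,k) η (η/2)`, which it does not contain. [folklore] -/
theorem crossInc_segment_eq_zero_of {A B : ℂ} {x : Site 2} {k : Fin 4}
    (h : ∀ z ∈ segment ℝ A B, z ∈ segment ℝ (framePt δ (x, k) (η - η / 4) (η / 2))
      (framePt δ (x, k) (η + η / 4) (η / 2)) → False) :
    (Path.segment A B).crossInc (framePt δ (x, k) (η - η / 4) (η / 2)) (framePt δ (x, k) (η + η / 4) (η / 2)) = 0 :=
  Path.crossInc_eq_zero _ fun t ht => h _ (by rw [← Path.range_segment]; exact mem_range_self t) ht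

/-- **The second half-side of `d` crosses the test segment of `d` once, positively**: crossing defect
`2πi`. [folklore] -/
theorem crossInc_halfSide_self (hη : 0 < η) (x : Site 2) (k : Fin 4) :
    (Path.segment (framePt δ (x, k) η 0) (framePt δ (x, k) η η)).crossInc
      (framePt δ (x, k) (η - η / 4) (η / 2)) (framePt δ (x, k) (η + η / 4) (η / 2)) = 2 * π * I := by
  apply Path.crossInc_segment_of_cross
  · rw [segSide_framePt]; nlinarith
  · rw [segSide_framePt]; nlinarith
  · refine ⟨framePt δ (x, k) η (η / 2), framePt_mem_segment_snd δ (x, k) η (by linarith) (by linarith) hη, ?_⟩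
    rw [openSegment_eq_image_lineMap]
    refine ⟨1 / 2, ⟨by norm_num, by norm_num⟩, ?_⟩
    rw [framePt_lineMap_fst]
    congr 1; ring

/-- The first half-side of any dart misses the test segment: zero crossing defect. [folklore] -/
theorem crossInc_halfSide_start (hδ : 0 < δ) (hη : 0 < η) (h4 : 4 * η ≤ δ) (x : Site 2) (k : Fin 4)
    (d' : Site 2 × Fin 4) :
    (Path.segment (framePt δ d' η (-η)) (framePt δ d' η 0)).crossInc
      (framePt δ (x, k) (η - η / 4) (η / 2)) (framePt δ (x, k) (η + η / 4) (η / 2)) = 0 := by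
  refine crossInc_segment_eq_zero_of fun z hz hz' => ?_
  obtain ⟨rfl, hzeq⟩ := eq_of_side_mem_testSegment hδ hη h4 (segment_start_bud_subset hη _ hz) hz'
  obtain ⟨s, ⟨-, hs1⟩, rfl⟩ := exists_of_mem_segment_snd (by linarith) hz
  have := (framePt_inj_iff.1 hzeq).2
  linarith

/-- The second half-side of a dart OTHER than `d` misses the test segment of `d`. [folklore] -/
theorem crossInc_halfSide_end_of_ne (hδ : 0 < δ) (hη : 0 < η) (h4 : 4 * η ≤ δ) (x : Site 2) (k : Fin 4)
    {d' : Site 2 × Fin 4} (hne : d' ≠ (x, k)) :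
    (Path.segment (framePt δ d' η 0) (framePt δ d' η η)).crossInc
      (framePt δ (x, k) (η - η / 4) (η / 2)) (framePt δ (x, k) (η + η / 4) (η / 2)) = 0 := by
  refine crossInc_segment_eq_zero_of fun z hz hz' => ?_
  exact hne (eq_of_side_mem_testSegment hδ hη h4 (segment_bud_end_subset hη _ hz) hz').1

/-- The connector misses the test segment: zero crossing defect. [folklore] -/
theorem crossInc_linkPath (hδ : 0 < δ) (hη : 0 < η) (h4 : 4 * η ≤ δ) (x : Site 2) (k : Fin 4)
    (d' : Site 2 × Fin 4) :
    (linkPath E δ η d').crossInc (framePt δ (x, k) (η - η / 4) (η / 2)) (framePt δ (x, k) (η + η / 4) (η / 2)) = 0 := by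
  refine Path.crossInc_eq_zero _ fun t ht => ?_
  rcases range_linkPath_subset (δ := δ) (η := η) (E := E) (by linarith) d' (mem_range_self t) with
    h | ⟨e, he, t₀, ht₀, hz⟩
  · rw [h] at ht
    obtain ⟨v, K⟩ := d'
    obtain ⟨hvK, hzeq⟩ := eq_of_side_mem_testSegment hδ hη h4 (right_mem_segment _ _ _) ht
    rw [hvK, framePt_inj_iff] at hzeq
    linarith [hzeq.2]
  · exact not_conn_mem_testSegment hδ hη h4 he ht₀ hz ht

/-- **Crossing defect of one step**: `2πi` for the step from the bud of `d` itself, `0` otherwise.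
[folklore] -/
theorem crossInc_stepPath (hδ : 0 < δ) (hη : 0 < η) (h4 : 4 * η ≤ δ) (x : Site 2) (k : Fin 4)
    (d' : Site 2 × Fin 4) :
    (stepPath E δ η d').crossInc (framePt δ (x, k) (η - η / 4) (η / 2)) (framePt δ (x, k) (η + η / 4) (η / 2)) =
      if d' = (x, k) then 2 * π * I else 0 := by
  obtain ⟨hn, hp, hn0, hp0⟩ := test_offsets hη
  have hℓ := testPt_not_mem_range_stepPath (E := E) hδ hη h4 x k hn hn0 d'
  have hr := testPt_not_mem_range_stepPath (E := E) hδ hη h4 x k hp hp0 d'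
  rw [show η + -(η / 4) = η - η / 4 by ring] at hℓ
  simp only [stepPath, Path.trans_range, mem_union, not_or] at hℓ hr
  obtain ⟨hℓ1, hℓ2, hℓ3⟩ := hℓ
  obtain ⟨hr1, hr2, hr3⟩ := hr
  simp only [stepPath]
  rw [Path.crossInc_trans _ _ hℓ1 (by simp only [Path.trans_range, mem_union, not_or]; exact ⟨hℓ2, hℓ3⟩) hr1
    (by simp only [Path.trans_range, mem_union, not_or]; exact ⟨hr2, hr3⟩),
    Path.crossInc_trans _ _ hℓ2 hℓ3 hr2 hr3, crossInc_linkPath hδ hη h4, crossInc_halfSide_start hδ hη h4,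
    add_zero, add_zero]
  split_ifs with h
  · subst h; exact crossInc_halfSide_self hη x k
  · exact crossInc_halfSide_end_of_ne hδ hη h4 x k h

/-- Crossing defect of one more step of the polygon (definitional unfolding). [folklore] -/
theorem crossInc_arcPath_succ (d' : Site 2 × Fin 4) (m : ℕ) (ℓ r : ℂ) :
    (arcPath E δ η d' (m + 1)).crossInc ℓ r = ((stepPath E δ η d').trans (arcPath E δ η (succ E d') m)).crossInc ℓ r :=
  rfl

/-- **Crossing defect of the polygon**: `2πi` times the number of visits of the dart `d` among the first `m`
darts. [folklore] -/
theorem crossInc_arcPath (hδ : 0 < δ) (hη : 0 < η) (h4 : 4 * η ≤ δ) (x : Site 2) (k : Fin 4) :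
    ∀ (m : ℕ) (d' : Site 2 × Fin 4),
      (arcPath E δ η d' m).crossInc (framePt δ (x, k) (η - η / 4) (η / 2)) (framePt δ (x, k) (η + η / 4) (η / 2)) =
        ∑ i ∈ Finset.range m, if (succ E)^[i] d' = (x, k) then 2 * π * I else 0
  | 0, d' => by
    rw [Finset.sum_range_zero]
    exact Path.crossInc_refl _ _ _
  | m + 1, d' => by
    obtain ⟨hn, hp, hn0, hp0⟩ := test_offsets hη
    have hℓ := testPt_not_mem_range_arcPath (E := E) hδ hη h4 x k hn hn0 d' (m + 1)
    have hr := testPt_not_mem_range_arcPath (E := E) hδ hη h4 x k hp hp0 d' (m + 1)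
    rw [show η + -(η / 4) = η - η / 4 by ring] at hℓ
    rw [range_arcPath_succ, mem_union, not_or] at hℓ hr
    rw [crossInc_arcPath_succ, Path.crossInc_trans _ _ hℓ.1 hℓ.2 hr.1 hr.2, crossInc_stepPath hδ hη h4,
      crossInc_arcPath hδ hη h4 x k m (succ E d'), Finset.sum_range_succ', add_comm]
    rfl

/-! ### The jump of the winding number across a bud -/

variable {d₀ : Site 2 × Fin 4} {N : ℕ}

/-- The crossing defect does not see a cast of the endpoints (private copy of `Path.crossInc_cast` of
`MedialCycleSeparation.lean`, not imported to keep this file light). [folklore] -/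
private theorem crossInc_cast {a b a' b' : ℂ} (γ : Path a b) (ha : a' = a) (hb : b' = b) (ℓ r : ℂ) :
    (γ.cast ha hb).crossInc ℓ r = γ.crossInc ℓ r := by
  subst ha hb; rfl

/-- The closed polygon as a loop based at the bud of `d₀`. [folklore] -/
theorem framePt_iterate_period (hN : (succ E)^[N] d₀ = d₀) :
    framePt δ d₀ η 0 = framePt δ ((succ E)^[N] d₀) η 0 := by rw [hN]

/-- **Winding numbers about the two test points of an arrow `d = (x, k)`** differ by the number of visits
of `d` by the cycle: `wind (Γ - ℓ_d) - wind (Γ - r_d) = #{i < N : succ^[i] d₀ = d}` (as a sum of ones).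
[folklore] -/
theorem wind_test_sub_eq_sum (hδ : 0 < δ) (hη : 0 < η) (h4 : 4 * η ≤ δ) (hN : (succ E)^[N] d₀ = d₀)
    (x : Site 2) (k : Fin 4) :
    ((wind (fun t => (arcPath E δ η d₀ N).extend t - framePt δ (x, k) (η - η / 4) (η / 2)) : ℂ) -
        wind (fun t => (arcPath E δ η d₀ N).extend t - framePt δ (x, k) (η + η / 4) (η / 2))) * (2 * π * I) =
      ∑ i ∈ Finset.range N, if (succ E)^[i] d₀ = (x, k) then 2 * π * I else 0 := by
  obtain ⟨hn, hp, hn0, hp0⟩ := test_offsets hη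
  have hℓ := testPt_not_mem_range_arcPath (E := E) hδ hη h4 x k hn hn0 d₀ N
  have hr := testPt_not_mem_range_arcPath (E := E) hδ hη h4 x k hp hp0 d₀ N
  rw [show η + -(η / 4) = η - η / 4 by ring] at hℓ
  have hℓ' : framePt δ (x, k) (η - η / 4) (η / 2) ∉
      range ((arcPath E δ η d₀ N).cast rfl (framePt_iterate_period hN)) := by rwa [Path.cast_coe]
  have hr' : framePt δ (x, k) (η + η / 4) (η / 2) ∉
      range ((arcPath E δ η d₀ N).cast rfl (framePt_iterate_period hN)) := by rwa [Path.cast_coe]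
  have h1 := Path.crossInc_loop _ hℓ' hr'
  rw [crossInc_cast, crossInc_arcPath hδ hη h4 x k N d₀] at h1
  simp only [Path.extend_cast] at h1
  exact h1.symm

/-- **The winding number jumps by one across the bud of a dart of the cycle.** [folklore] -/
theorem wind_test_eq_add_one (hδ : 0 < δ) (hη : 0 < η) (h4 : 4 * η ≤ δ) (hN : (succ E)^[N] d₀ = d₀)
    (hinj : ∀ i j, i < N → j < N → (succ E)^[i] d₀ = (succ E)^[j] d₀ → i = j) {j : ℕ} (hj : j < N)
    {x : Site 2} {k : Fin 4} (hd : (succ E)^[j] d₀ = (x, k)) :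
    wind (fun t => (arcPath E δ η d₀ N).extend t - framePt δ (x, k) (η - η / 4) (η / 2)) =
      wind (fun t => (arcPath E δ η d₀ N).extend t - framePt δ (x, k) (η + η / 4) (η / 2)) + 1 := by
  have h := wind_test_sub_eq_sum (δ := δ) hδ hη h4 hN x k
  rw [Finset.sum_eq_single j, if_pos hd] at h
  · have h2 : ((wind (fun t => (arcPath E δ η d₀ N).extend t - framePt δ (x, k) (η - η / 4) (η / 2)) : ℂ) -
        wind (fun t => (arcPath E δ η d₀ N).extend t - framePt δ (x, k) (η + η / 4) (η / 2))) = 1 := by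
      have hne : (2 * π * I : ℂ) ≠ 0 := by simp [Real.pi_ne_zero, I_ne_zero]
      have := mul_right_cancel₀ hne (h.trans (one_mul _).symm)
      exact this
    have h3 := congrArg Complex.re h2
    simp only [sub_re, intCast_re, one_re] at h3
    have h4' : (wind (fun t => (arcPath E δ η d₀ N).extend t - framePt δ (x, k) (η - η / 4) (η / 2)) : ℝ) =
        wind (fun t => (arcPath E δ η d₀ N).extend t - framePt δ (x, k) (η + η / 4) (η / 2)) + 1 := by linarith
    exact_mod_cast h4'
  · intro i hi hij
    rw [if_neg]
    intro h'
    exact hij (hinj i j (Finset.mem_range.1 hi) hj (h'.trans hd.symm))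
  · intro h'
    exact absurd (Finset.mem_range.2 hj) h'

/-- **No jump across the bud of an arrow that is not a dart of the cycle.** [folklore] -/
theorem wind_test_eq (hδ : 0 < δ) (hη : 0 < η) (h4 : 4 * η ≤ δ) (hN : (succ E)^[N] d₀ = d₀)
    {x : Site 2} {k : Fin 4} (hd : ∀ j < N, (succ E)^[j] d₀ ≠ (x, k)) :
    wind (fun t => (arcPath E δ η d₀ N).extend t - framePt δ (x, k) (η - η / 4) (η / 2)) =
      wind (fun t => (arcPath E δ η d₀ N).extend t - framePt δ (x, k) (η + η / 4) (η / 2)) := by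
  have h := wind_test_sub_eq_sum (δ := δ) hδ hη h4 hN x k
  rw [Finset.sum_eq_zero (fun i hi => if_neg (hd i (Finset.mem_range.1 hi))), mul_eq_zero] at h
  rcases h with h | h
  · have h3 := congrArg Complex.re h
    simp only [sub_re, intCast_re, zero_re] at h3
    have h4' : (wind (fun t => (arcPath E δ η d₀ N).extend t - framePt δ (x, k) (η - η / 4) (η / 2)) : ℝ) =
        wind (fun t => (arcPath E δ η d₀ N).extend t - framePt δ (x, k) (η + η / 4) (η / 2)) := by linarith
    exact_mod_cast h4'
  · exfalso
    simp [Real.pi_ne_zero, I_ne_zero] at h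

end WindowRect

/-- **No jump of the winding number across the bud of an arrow off the cycle**, closed form (registered
sub-goal of stmt-CriticalPhenomena-10650). [folklore] -/
theorem windowRect_wind_test_eq : ∀ {δ η : ℝ} {E : Finset (Sym2 (Site 2))} {d₀ : Site 2 × Fin 4} {N : ℕ}, 0 < δ → 0 < η → 4 * η ≤ δ → (DiscreteRect.succ E)^[N] d₀ = d₀ → ∀ {x : Site 2} {k : Fin 4}, (∀ j < N, (DiscreteRect.succ E)^[j] d₀ ≠ (x, k)) → wind (fun t => (WindowRect.arcPath E δ η d₀ N).extend t - WindowRect.framePt δ (x, k) (η - η / 4) (η / 2)) = wind (fun t => (WindowRect.arcPath E δ η d₀ N).extend t - WindowRect.framePt δ (x, k) (η + η / 4) (η / 2)) :=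
  fun hδ hη h4 hN _ _ hd => WindowRect.wind_test_eq hδ hη h4 hN hd

end Summit.CriticalPhenomena.SAWScalingLimit.Theorems.IsingBoundaryRatio

end
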